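import Mathlib
import Summits.NavierStokesRegularity.NavierStokesRegularity.Theorems.TaoLadderRungTwoFlatBehindAprioriSharp
import Summits.NavierStokesRegularity.NavierStokesRegularity.Theorems.TaoLadderRungTwoFlatNearHopStart
import HarnessLib

/-!
# The JOINT near/behind in-hop a-priori loop (referee c88 W-25): the near zone's deviation energy and the behind zone's
  clock-weighted amplitudes control each other during the hop, modulo the CORE inputs at the window bottom `1 − K`
  (helper for the K_A♭ parent item stmt-NavierStokesRegularity-22987 `FlatGapCertificatesV2`, child 2A `GradedAdiabaticWakeA`
  of route TaoLadderRungTwoFlat; cell harvest/h2-tao-ladder, p1 g23; LADDER §49 (L8b), §54–§56)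

Two exact graded window flows on `[0, τ]`: the reference `W` (template) and the hop flow `S`; deviation `u = S − W`.
The near hop (`HopTube.near_hop_of_pseudoFlows_amp`) consumes an a-priori DEVIATION amplitude `A` on the near shells
`[−D, 1−K]`; the behind hop (`R54.behindEnergyClause_hop_topInput`) consumes the clock-weighted amplitude `A_eff` behind and
the interface amplitude `A₁ ≥ |v_{−K}(t)|`. Each is the other's output: the behind bootstrap
(`R54.behind_apriori_of_pseudoFlow_sharp`) turns `A₁` into `clock·|S| ≤ A_eff` on every behind bond, which bounds `|u| ≤
A_eff/clock(−D−1) + M` on the near shells; the near deviation energy `V_N(t) ≤ V̄_N` bounds `|v_{−K}(t)| ≤ M₁ + √(2V̄_N)e^{θ_V/2}`.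
This module closes that loop by continuous induction on the near deviation energy, calling the behind bootstrap on every
initial segment `[0, t]` (with the co-moving speed `1/t`), so that the ONLY remaining in-hop inputs are the CORE ones: the
deviation `|u_i(1−K, t)| ≤ r` at the core window's bottom shell (both species) and the template bounds `M`, `M₁`.

* `near_behind_hop_of_schedule` — the NEAR and BEHIND landing clauses of `H(n+1)` together (`NearClause (n+1)` ∧
  `R54.BehindEnergyClause K θ′ W′` of the re-centred state) from the loop below plus the near template residual and the two
  budgets: both zones closed modulo the CORE inputs and the named schedule hypotheses;
* `near_behind_apriori_of_pseudoFlows` — outputs, for all `t ∈ [0, τ₁]`: (i) `clock·|S| ≤ A_eff` on every behind bond;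
  (ii) `|u| ≤ A := A_eff/clock(−D−1) + M` on the near shells `[−D, 1−K]`; (iii) `V_N(t) ≤ V̄_N`; (iv) `|S_1(−K, t)| ≤ A₁`.
  Inputs: template bounds, core inputs `r` (`r ≤ A`, `M + r ≤ A_eff`), initial levels `V₀N`, `V₀B` (all behind blocks), the two
  rates, and three scalar closing conditions (near level `V₀N + Ē_N·τ₁ < V̄_N`, behind level `V₀B + Ē_top·τ₁ < V̄_B`, behind
  gauge `√(2V̄_B)e^{θ′/2} ≤ A_eff`), with `Ē_N = e^{θ_V(1−D+K)}(1+ε)A²(A+M) + (1+ε)r(A²+Mr)`, `Ē_top = A₁A₀(A₁+εA₀)`, `A₀ = M + r`.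

HONEST FRAMING: inequalities about MODEL-lattice certificate flows (graded mirror table on `S♭`, `m = 2`); the core inputs,
template bounds and scalar schedule inequalities are HYPOTHESES; nothing certified; no item closed; nothing about the
Navier–Stokes equations.
-/

noncomputable section

-- the sub-problem namespace repeats the summit name by design (D-0017)
set_option linter.dupNamespace false

namespace Summit.NavierStokesRegularity.NavierStokesRegularity.Theorems.HopTube.R54

open Set Finset Literature.Analysis.FluidPDE Literature.Analysis.FluidPDE.TaoCascade MirrorPulse

section Joint

variable {ε ε₀ τ κ₂ κ₂' : ℝ} {W₀ FW₀ BW₀ S₀ FS₀ BS₀ : Fin 2 → ℤ → ℝ} {W FW S FS : Fin 2 → ℤ → ℝ → ℝ}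

/-- From a clock-weighted bound `clock(n)·x ≤ A_eff` and `clock(n) ≥ clock(n₀) > 0`: `x ≤ A_eff / clock(n₀)` (`x ≥ 0`).
[cite: Tao2016AveragedNS, §4 (4.1); route TaoLadderRungTwoFlat, L-54a read on the near block (cell LADDER §54)] -/
theorem le_div_clock_of_clockWeighted {ε₀ Aeff x : ℝ} (hε₀ : 0 ≤ ε₀) {n₀ n : ℤ} (hn : n₀ ≤ n) (hx : 0 ≤ x)
    (h : clock ε₀ n * x ≤ Aeff) : x ≤ Aeff / clock ε₀ n₀ := by
  have hc0 : 0 < clock ε₀ n₀ := by unfold clock; exact Real.rpow_pos_of_pos (by linarith) _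
  rw [le_div_iff₀ hc0]
  calc x * clock ε₀ n₀ ≤ x * clock ε₀ n := mul_le_mul_of_nonneg_left (clock_mono hε₀ hn) hx
    _ = clock ε₀ n * x := mul_comm _ _
    _ ≤ Aeff := h

/-- **Near-shell deviation amplitude from the behind clock-weighted bound** at one time: `clock·|S| ≤ A_eff` on every behind
bond, the template bound `M` on `[−D, 1−K]` and the core input `r ≤ A` at the shell `1−K` give `|u_i(m)| ≤ A :=
A_eff/clock(−D−1) + M` for every `m ∈ [−D, 1−K]`. [cite: Tao2016AveragedNS, §4 (4.1), (4.3); route TaoLadderRungTwoFlat, L8b a-priori input `hA` of `HopTube.near_hop_of_pseudoFlows` (cell LADDER §49, §54)] -/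
theorem near_deviation_amp_of_behind {ε₀ Aeff M r : ℝ} (hε₀ : 0 ≤ ε₀) {K D : ℕ}
    {S W : Fin 2 → ℤ → ℝ → ℝ} {t : ℝ}
    (hbd : ∀ n : ℤ, n ≤ -(K : ℤ) → clock ε₀ n * |S 1 n t| ≤ Aeff ∧ clock ε₀ n * |S 0 (n + 1) t| ≤ Aeff)
    (hM : ∀ i, ∀ m ∈ Finset.Icc (-(D : ℤ)) (1 - (K : ℤ)), |W i m t| ≤ M)
    (hr : ∀ i, |(S - W) i (1 - (K : ℤ)) t| ≤ r) (hrA : r ≤ Aeff / clock ε₀ (-(D : ℤ) - 1) + M)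
    (i : Fin 2) {m : ℤ} (hm : m ∈ Finset.Icc (-(D : ℤ)) (1 - (K : ℤ))) :
    |(S - W) i m t| ≤ Aeff / clock ε₀ (-(D : ℤ) - 1) + M := by
  have hm' := Finset.mem_Icc.mp hm
  rcases eq_or_lt_of_le hm'.2 with heq | hlt
  · rw [heq]; exact (hr i).trans hrA
  · have hmK : m ≤ -(K : ℤ) := by omega
    have hSi : |S i m t| ≤ Aeff / clock ε₀ (-(D : ℤ) - 1) := by
      fin_cases i
      · have h := (hbd (m - 1) (by omega)).2
        rw [sub_add_cancel] at h
        exact le_div_clock_of_clockWeighted hε₀ (by omega) (abs_nonneg _) h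
      · exact le_div_clock_of_clockWeighted hε₀ (by omega) (abs_nonneg _) (hbd m hmK).1
    have hWi := hM i m hm
    calc |(S - W) i m t| = |S i m t - W i m t| := by simp only [Pi.sub_apply]
      _ ≤ |S i m t| + |W i m t| := abs_sub _ _
      _ ≤ Aeff / clock ε₀ (-(D : ℤ) - 1) + M := add_le_add hSi hWi

/-- **The interface amplitude from the near deviation energy** at one time: `V_N(t) ≤ V̄_N` (block `[1−D, −K]`, edge
`−K + σt`, `σt ≤ 1`, `0 ≤ θ_V`) and `|W_1(−K, t)| ≤ M₁` give `|S_1(−K, t)| ≤ M₁ + √(2V̄_N)·e^{θ_V/2}`.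
[cite: Tao2016AveragedNS, §4 (4.3); route TaoLadderRungTwoFlat, the behind zone's interface input `A₁` (cell LADDER §54.8, referee c88 W-25)] -/
theorem interface_amp_of_nearEnergy {θV σ VbarN M₁ : ℝ} (hθV : 0 ≤ θV) {K D : ℕ} (hDK : K + 1 ≤ D)
    {S W : Fin 2 → ℤ → ℝ → ℝ} {t : ℝ} (hσt1 : σ * t ≤ 1)
    (hV : coMovingEnergyOn (Finset.Icc (1 - (D : ℤ)) (-(K : ℤ))) θV (-(K : ℝ) + σ * t) (S - W) t ≤ VbarN)
    (hM₁ : |W 1 (-(K : ℤ)) t| ≤ M₁) :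
    |S 1 (-(K : ℤ)) t| ≤ M₁ + Real.sqrt (2 * VbarN) * Real.exp (θV / 2) := by
  have hmem : (-(K : ℤ)) ∈ Finset.Icc (1 - (D : ℤ)) (-(K : ℤ)) := by
    have : ((K + 1 : ℕ) : ℤ) ≤ (D : ℤ) := by exact_mod_cast hDK
    push_cast at this
    simp only [Finset.mem_Icc]; omega
  have h1 := abs_le_of_blockEnergy_le hV 1 hmem
  have hexp : Real.exp (θV * ((-(K : ℝ) + σ * t) - ((-(K : ℤ) : ℤ) : ℝ)) / 2) ≤ Real.exp (θV / 2) := by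
    rw [Real.exp_le_exp]
    push_cast
    nlinarith
  have hs0 : 0 ≤ Real.sqrt (2 * VbarN) := Real.sqrt_nonneg _
  have h2 : |(S - W) 1 (-(K : ℤ)) t| ≤ Real.sqrt (2 * VbarN) * Real.exp (θV / 2) :=
    h1.trans (mul_le_mul_of_nonneg_left hexp hs0)
  have h3 : |S 1 (-(K : ℤ)) t| ≤ |W 1 (-(K : ℤ)) t| + |(S - W) 1 (-(K : ℤ)) t| := by
    have e : S 1 (-(K : ℤ)) t = W 1 (-(K : ℤ)) t + (S - W) 1 (-(K : ℤ)) t := by simp only [Pi.sub_apply]; ring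
    rw [e]; exact abs_add_le _ _
  linarith

/-- **The core window's bottom carrier during the hop**: template `M` on `[−D, 1−K]` and core input `r` give
`|a_{1−K}(t)| = |S_0(1−K, t)| ≤ M + r`. [cite: Tao2016AveragedNS, §4 (4.3); route TaoLadderRungTwoFlat, the behind zone's interface input `A₀` (cell LADDER §54.8)] -/
theorem coreBottom_amp_le {M r : ℝ} {K D : ℕ} (hDK : K + 1 ≤ D) {S W : Fin 2 → ℤ → ℝ → ℝ} {t : ℝ}
    (hM : ∀ i, ∀ m ∈ Finset.Icc (-(D : ℤ)) (1 - (K : ℤ)), |W i m t| ≤ M)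
    (hr : ∀ i, |(S - W) i (1 - (K : ℤ)) t| ≤ r) :
    |S 0 (-(K : ℤ) + 1) t| ≤ M + r := by
  have e1 : (-(K : ℤ) + 1) = 1 - (K : ℤ) := by ring
  rw [e1]
  have hmem : (1 - (K : ℤ)) ∈ Finset.Icc (-(D : ℤ)) (1 - (K : ℤ)) := by
    simp only [Finset.mem_Icc]; omega
  have h1 := hM 0 _ hmem
  have h2 := hr 0
  have e : S 0 (1 - (K : ℤ)) t = W 0 (1 - (K : ℤ)) t + (S - W) 0 (1 - (K : ℤ)) t := by
    simp only [Pi.sub_apply]; ring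
  rw [e]
  exact (abs_add_le _ _).trans (add_le_add h1 h2)

/-- **THE JOINT NEAR/BEHIND IN-HOP A-PRIORI LOOP.** See the module docstring.
[cite: Tao2016AveragedNS, §4 (4.1), (4.3), (4.5), (4.8), §5 (continuity argument, statement shape); route TaoLadderRungTwoFlat, L8b + R54-1 joint loop (cell LADDER §49.5, §54.8–54.9, referee c88 W-25)] -/
theorem near_behind_apriori_of_pseudoFlows
    (hW : PseudoFlowOnShift shiftSetFlat τ ε₀ (mirrorTable ε ε) 0 κ₂ W₀ FW₀ BW₀ W FW)
    (hS : PseudoFlowOnShift shiftSetFlat τ ε₀ (mirrorTable ε ε) 0 κ₂' S₀ FS₀ BS₀ S FS)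
    (hε : 0 ≤ ε) (hε₀ : 0 < ε₀) {K D : ℕ} (hDK : K + 1 ≤ D)
    {θV θ' σ τ₁ Aeff A A₀ A₁ M M₁ r μN μB V₀N V₀B VbarN VbarB : ℝ}
    (hθV : 0 ≤ θV) (hθ : 0 ≤ θ') (hθ5 : θ' ≤ 5 * Real.log (1 + ε₀)) (hAeff : 0 < Aeff)
    (hτ₁ : 0 < τ₁) (hτ₁τ : τ₁ ≤ τ) (hστ : σ * τ₁ = 1)
    (hM0 : 0 ≤ M) (hM : ∀ t ∈ Icc 0 τ₁, ∀ i, ∀ m ∈ Finset.Icc (-(D : ℤ)) (1 - (K : ℤ)), |W i m t| ≤ M)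
    (hM₁ : ∀ t ∈ Icc 0 τ₁, |W 1 (-(K : ℤ)) t| ≤ M₁)
    (hr : ∀ t ∈ Icc 0 τ₁, ∀ i, |(S - W) i (1 - (K : ℤ)) t| ≤ r) (hr0 : 0 ≤ r)
    (hAdef : A = Aeff / clock ε₀ (-(D : ℤ) - 1) + M) (hA₀def : A₀ = M + r)
    (hA₁def : A₁ = M₁ + Real.sqrt (2 * VbarN) * Real.exp (θV / 2))
    (hrA : r ≤ A) (hA₀le : A₀ ≤ Aeff)
    (hV₀N : coMovingEnergyOn (Finset.Icc (1 - (D : ℤ)) (-(K : ℤ))) θV (-(K : ℝ)) (S - W) 0 ≤ V₀N)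
    (hV₀B : ∀ L : ℕ, coMovingEnergyOn (Finset.Icc (1 - (K : ℤ) - L) (-(K : ℤ))) θ' (-(K : ℝ)) S 0 ≤ V₀B)
    (hμN : 0 < μN)
    (hμNle : μN ≤ σ * θV - 2 * (1 + ε) * 1 * (A * Real.sinh (θV / 2) + M * (3 + Real.exp θV)))
    (hμB : 0 < μB) (hμBle : μB ≤ σ * θ' - 2 * (1 + ε) * Aeff * Real.sinh (θ' / 2))
    (hlevN : V₀N + (Real.exp (θV * ((1 : ℝ) - D + K)) * ((1 + ε) * 1 * A ^ 2 * (A + M))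
        + (1 + ε) * 1 * r * (A ^ 2 + M * r)) * τ₁ < VbarN)
    (hlevB : V₀B + A₁ * A₀ * (A₁ + ε * A₀) * τ₁ < VbarB)
    (hclose : Real.sqrt (2 * VbarB) * Real.exp (θ' / 2) ≤ Aeff) :
    (∀ t ∈ Icc 0 τ₁, ∀ n : ℤ, n ≤ -(K : ℤ) →
        clock ε₀ n * |S 1 n t| ≤ Aeff ∧ clock ε₀ n * |S 0 (n + 1) t| ≤ Aeff) ∧
      (∀ t ∈ Icc 0 τ₁, ∀ i, ∀ m ∈ Finset.Icc (-(D : ℤ)) (1 - (K : ℤ)), |(S - W) i m t| ≤ A) ∧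
      (∀ t ∈ Icc 0 τ₁,
        coMovingEnergyOn (Finset.Icc (1 - (D : ℤ)) (-(K : ℤ))) θV (-(K : ℝ) + σ * t) (S - W) t ≤ VbarN) ∧
      (∀ t ∈ Icc 0 τ₁, |S 1 (-(K : ℤ)) t| ≤ A₁) := by
  subst hAdef hA₀def hA₁def
  have hσ : 0 < σ := pos_of_mul_pos_left (by rw [hστ]; exact one_pos) hτ₁.le
  have hε₀' : (-1 : ℝ) ≤ ε₀ := by linarith
  have haP : (1 - (D : ℤ)) ≤ -(K : ℤ) := by
    have : ((K + 1 : ℕ) : ℤ) ≤ (D : ℤ) := by exact_mod_cast hDK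
    push_cast at this; omega
  -- abbreviations (the statement spells them out through `hAdef`, `hA₀def`, `hA₁def`)
  set A : ℝ := Aeff / clock ε₀ (-(D : ℤ) - 1) + M with hAdef
  set A₀ : ℝ := M + r with hA₀def
  set A₁ : ℝ := M₁ + Real.sqrt (2 * VbarN) * Real.exp (θV / 2) with hA₁def
  have hApos : 0 ≤ A := hr0.trans hrA
  have hA₀0 : 0 ≤ A₀ := by rw [hA₀def]; positivity
  -- the near edge input
  set EN : ℝ := Real.exp (θV * ((1 : ℝ) - D + K)) * ((1 + ε) * 1 * A ^ 2 * (A + M))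
      + (1 + ε) * 1 * r * (A ^ 2 + M * r) with hENdef
  have hEN0 : 0 ≤ EN := by positivity
  have hEtop0 : 0 ≤ A₁ * A₀ * (A₁ + ε * A₀) := by
    have hA₁0 : 0 ≤ A₁ := by
      rw [hA₁def]
      have := (abs_nonneg _).trans (hM₁ 0 ⟨le_rfl, hτ₁.le⟩)
      positivity
    positivity
  -- the core's bottom carrier during the hop: `|a_{1−K}| ≤ M + r = A₀`
  have hA₀ : ∀ t ∈ Icc 0 τ₁, |S 0 (-(K : ℤ) + 1) t| ≤ A₀ := fun t ht => coreBottom_amp_le hDK (hM t ht) (hr t ht)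
  -- STEP A: a near-energy level `≤ V̄_N` on `[0, t]` gives the behind clock-weighted bound on `[0, t]`
  --         (the behind bootstrap on the initial segment, co-moving speed `1/t`)
  have stepA : ∀ t ∈ Icc 0 τ₁, 0 < t →
      (∀ s ∈ Icc 0 t, coMovingEnergyOn (Finset.Icc (1 - (D : ℤ)) (-(K : ℤ))) θV (-(K : ℝ) + σ * s) (S - W) s
        ≤ VbarN) →
      ∀ s ∈ Icc 0 t, ∀ n : ℤ, n ≤ -(K : ℤ) →
        clock ε₀ n * |S 1 n s| ≤ Aeff ∧ clock ε₀ n * |S 0 (n + 1) s| ≤ Aeff := by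
    intro t ht htpos hpast
    have htτ : t ≤ τ := ht.2.trans hτ₁τ
    have hσ't : (1 / t) * t = 1 := by field_simp
    -- interface amplitude on `[0, t]`
    have hA₁ : ∀ s ∈ Ioo 0 t, |S 1 (-(K : ℤ)) s| ≤ A₁ := by
      intro s hs
      have hs' : s ∈ Icc 0 t := ⟨hs.1.le, hs.2.le⟩
      have hσs : σ * s ≤ 1 := by
        calc σ * s ≤ σ * τ₁ := mul_le_mul_of_nonneg_left (hs.2.le.trans ht.2) hσ.le
          _ = 1 := hστ
      exact interface_amp_of_nearEnergy hθV hDK hσs (hpast s hs') (hM₁ s ⟨hs.1.le, hs.2.le.trans ht.2⟩)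
    have ht0 : (0 : ℝ) ≤ 1 / t := by positivity
    have hEtop : ∀ s ∈ Ioo 0 t,
        Real.exp (θ' * ((((-(K : ℤ)) : ℤ) : ℝ) - (-(K : ℝ) + (1 / t) * s))) * |fluxT ε ε₀ S (-(K : ℤ)) s|
          ≤ A₁ * A₀ * (A₁ + ε * A₀) := fun s hs =>
      weighted_topFlux_le hε hε₀.le hθ K S (mul_nonneg ht0 hs.1.le) (hA₁ s hs)
        (hA₀ s ⟨hs.1.le, hs.2.le.trans ht.2⟩)
    have h1t : σ ≤ 1 / t := by
      rw [le_div_iff₀ htpos]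
      calc σ * t ≤ σ * τ₁ := mul_le_mul_of_nonneg_left ht.2 hσ.le
        _ = 1 := hστ
    have hμB' : μB ≤ (1 / t) * θ' - 2 * (1 + ε) * Aeff * Real.sinh (θ' / 2) := by
      have h2 : σ * θ' ≤ (1 / t) * θ' := mul_le_mul_of_nonneg_right h1t hθ
      linarith
    have hlev' : V₀B + A₁ * A₀ * (A₁ + ε * A₀) * t < VbarB := by
      have h3 : A₁ * A₀ * (A₁ + ε * A₀) * t ≤ A₁ * A₀ * (A₁ + ε * A₀) * τ₁ :=
        mul_le_mul_of_nonneg_left ht.2 hEtop0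
      linarith
    have hA₀' : ∀ s ∈ Icc 0 t, |S 0 (-(K : ℤ) + 1) s| ≤ A₀ := fun s hs => hA₀ s ⟨hs.1, hs.2.trans ht.2⟩
    exact behind_apriori_of_pseudoFlow_sharp (σ := 1 / t) (τ₁ := t) (Etop := A₁ * A₀ * (A₁ + ε * A₀))
      (V₀ := V₀B) (Vbar := VbarB) hS hε hε₀ hθ hθ5 hAeff htpos htτ hσ't hA₀' hA₀le hEtop hEtop0 hV₀B hμB hμB'
      hlev' hclose
  -- STEP B: continuous induction on the near deviation energy
  have hcont : ContinuousOn
      (fun t => coMovingEnergyOn (Finset.Icc (1 - (D : ℤ)) (-(K : ℤ))) θV (-(K : ℝ) + σ * t) (S - W) t)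
      (Icc 0 τ₁) := by
    refine continuousOn_coMovingEnergyOn _ fun i n _ => ?_
    have hS' := (QuadPolar.continuousOn_of_pseudoFlowOnShift hS i n).mono (Icc_subset_Icc le_rfl hτ₁τ)
    have hW' := (QuadPolar.continuousOn_of_pseudoFlowOnShift hW i n).mono (Icc_subset_Icc le_rfl hτ₁τ)
    have e : (S - W) i n = fun s => S i n s - W i n s := by funext s; simp
    rw [e]; exact hS'.sub hW'
  set ηN : ℝ := (VbarN - (V₀N + EN * τ₁)) / 2 with hηNdef
  have hηN0 : 0 < ηN := by rw [hηNdef]; linarith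
  have hba : V₀N + EN * τ₁ + ηN < VbarN := by rw [hηNdef]; linarith
  have h0 : coMovingEnergyOn (Finset.Icc (1 - (D : ℤ)) (-(K : ℤ))) θV (-(K : ℝ) + σ * 0) (S - W) 0
      ≤ V₀N + EN * τ₁ + ηN := by
    rw [mul_zero, add_zero]
    have : 0 ≤ EN * τ₁ := by positivity
    linarith
  have key := Bootstrap.Icc_induction (T := τ₁) (a := VbarN) (b := V₀N + EN * τ₁ + ηN) hτ₁.le hcont hba h0 ?_
  · -- conclusions
    have hnear : ∀ t ∈ Icc 0 τ₁,
        coMovingEnergyOn (Finset.Icc (1 - (D : ℤ)) (-(K : ℤ))) θV (-(K : ℝ) + σ * t) (S - W) t ≤ VbarN :=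
      fun t ht => (key t ht).trans hba.le
    have hbd := stepA τ₁ ⟨hτ₁.le, le_rfl⟩ hτ₁ hnear
    refine ⟨hbd, fun t ht i m hm => ?_, hnear, fun t ht => ?_⟩
    · exact near_deviation_amp_of_behind hε₀.le (hbd t ht) (hM t ht) (hr t ht) hrA i hm
    · have hσt : σ * t ≤ 1 := by
        calc σ * t ≤ σ * τ₁ := mul_le_mul_of_nonneg_left ht.2 hσ.le
          _ = 1 := hστ
      exact interface_amp_of_nearEnergy hθV hDK hσt (hnear t ht) (hM₁ t ht)
  · -- the step
    intro t ht hpast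
    rcases eq_or_lt_of_le ht.1 with h0t | htpos
    · rw [← h0t]; exact h0
    -- behind clock-weighted bound on `[0, t]`, then the near deviation amplitude there
    have hbd := stepA t ht htpos hpast
    have hAmp : ∀ s ∈ Ioo 0 t, ∀ i, ∀ m ∈ Finset.Icc (1 - (D : ℤ) - 1) (-(K : ℤ) + 1), |(S - W) i m s| ≤ A := by
      intro s hs i m hm
      have hs' : s ∈ Icc 0 t := ⟨hs.1.le, hs.2.le⟩
      have hs'' : s ∈ Icc 0 τ₁ := ⟨hs.1.le, hs.2.le.trans ht.2⟩
      have hm' : m ∈ Finset.Icc (-(D : ℤ)) (1 - (K : ℤ)) := by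
        simp only [Finset.mem_Icc] at hm ⊢; omega
      exact near_deviation_amp_of_behind hε₀.le (hbd s hs') (hM s hs'') (hr s hs'') hrA i hm'
    have hM' : ∀ s ∈ Ioo 0 t, ∀ i, ∀ m ∈ Finset.Icc (1 - (D : ℤ) - 1) (-(K : ℤ) + 1), |W i m s| ≤ M := by
      intro s hs i m hm
      refine hM s ⟨hs.1.le, hs.2.le.trans ht.2⟩ i m ?_
      simp only [Finset.mem_Icc] at hm ⊢; omega
    have hc' : ∀ m ∈ Finset.Icc (1 - (D : ℤ) - 1) (-(K : ℤ)), clock ε₀ m ≤ 1 := by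
      intro m hm
      simp only [Finset.mem_Icc] at hm
      exact clock_le_one_of_nonpos hε₀.le (by omega)
    -- the near edge input on `(0, t)`
    have hE : ∀ s ∈ Ioo 0 t,
        Real.exp (θV * (((1 - (D : ℤ) : ℤ) : ℝ) - (-(K : ℝ) + σ * s))) * |fluxT ε ε₀ (S - W) (1 - (D : ℤ) - 1) s|
          + Real.exp (θV * (((-(K : ℤ) : ℤ) : ℝ) - (-(K : ℝ) + σ * s))) * |fluxT ε ε₀ (S - W) (-(K : ℤ)) s|
          + (1 + ε) * 1 * M *
            (Real.exp (θV * (((1 - (D : ℤ) : ℤ) : ℝ) - (-(K : ℝ) + σ * s))) * (S - W) 1 (1 - (D : ℤ) - 1) s ^ 2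
              + Real.exp (θV * (((-(K : ℤ) : ℤ) : ℝ) - (-(K : ℝ) + σ * s))) * (S - W) 0 (-(K : ℤ) + 1) s ^ 2)
          ≤ EN := by
      intro s hs
      have hs'' : s ∈ Icc 0 τ₁ := ⟨hs.1.le, hs.2.le.trans ht.2⟩
      have hσs : 0 ≤ σ * s := (mul_pos hσ hs.1).le
      have hqa : |(S - W) 1 (1 - (D : ℤ) - 1) s| ≤ A := hAmp s hs 1 _ (by simp only [Finset.mem_Icc]; omega)
      have hpa : |(S - W) 0 (1 - (D : ℤ)) s| ≤ A := hAmp s hs 0 _ (by simp only [Finset.mem_Icc]; omega)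
      have hqP : |(S - W) 1 (-(K : ℤ)) s| ≤ A := hAmp s hs 1 _ (by simp only [Finset.mem_Icc]; omega)
      have hr' : |(S - W) 0 (-(K : ℤ) + 1) s| ≤ r := by
        have e1 : (-(K : ℤ) + 1) = 1 - (K : ℤ) := by ring
        rw [e1]; exact hr s hs'' 0
      have hPne : (((-(K : ℤ)) : ℤ) : ℝ) ≤ -(K : ℝ) + σ * s := by push_cast; linarith
      have hca : clock ε₀ (1 - (D : ℤ) - 1) ≤ 1 := clock_le_one_of_nonpos hε₀.le (by omega)
      have hcP : clock ε₀ (-(K : ℤ)) ≤ 1 := clock_le_one_of_nonpos hε₀.le (by omega)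
      have hedge := edgeInput_le (θ := θV) (ne := -(K : ℝ) + σ * s) hε hε₀' hθV hM0 (S - W) s hPne
        hqa hpa hqP hr' hrA hca hcP
      refine hedge.trans ?_
      have hX : 0 ≤ (1 + ε) * 1 * A ^ 2 * (A + M) := by positivity
      have hw : Real.exp (θV * ((((1 - (D : ℤ)) : ℤ) : ℝ) - (-(K : ℝ) + σ * s)))
          ≤ Real.exp (θV * ((1 : ℝ) - D + K)) := by
        rw [Real.exp_le_exp]
        push_cast
        exact mul_le_mul_of_nonneg_left (by linarith) hθV
      rw [hENdef]
      linarith [mul_le_mul_of_nonneg_right hw hX]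
    have htr := coMovingEnergyOn_decay_of_pseudoFlows (n₀ := -(K : ℝ)) (σ := σ) (θ := θV) hW hS hε hε₀' hθV
      haP le_rfl ht.1 (ht.2.trans hτ₁τ) hAmp hM' hc' hE hμN hμNle
    rw [sub_zero, mul_zero, add_zero] at htr
    have he1 : Real.exp (-μN * t) ≤ 1 := by
      rw [Real.exp_le_one_iff]
      have := mul_nonneg hμN.le ht.1
      linarith
    have hf0 : 0 ≤ coMovingEnergyOn (Finset.Icc (1 - (D : ℤ)) (-(K : ℤ))) θV (-(K : ℝ)) (S - W) 0 :=
      coMovingEnergyOn_nonneg _ _ _ _ _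
    have hexp : (1 - Real.exp (-μN * t)) / μN ≤ t := by
      rw [div_le_iff₀ hμN]
      have := Real.add_one_le_exp (-μN * t)
      linarith
    have hI : EN * (1 - Real.exp (-μN * t)) / μN ≤ EN * τ₁ := by
      rw [mul_div_assoc]
      exact mul_le_mul_of_nonneg_left (hexp.trans ht.2) hEN0
    calc coMovingEnergyOn (Finset.Icc (1 - (D : ℤ)) (-(K : ℤ))) θV (-(K : ℝ) + σ * t) (S - W) t
        ≤ Real.exp (-μN * t) * coMovingEnergyOn (Finset.Icc (1 - (D : ℤ)) (-(K : ℤ))) θV (-(K : ℝ)) (S - W) 0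
            + EN * (1 - Real.exp (-μN * t)) / μN := htr
      _ ≤ 1 * V₀N + EN * τ₁ := add_le_add (mul_le_mul he1 hV₀N hf0 zero_le_one) hI
      _ ≤ V₀N + EN * τ₁ + ηN := by linarith

/-- **THE NEAR AND BEHIND HOPS CLOSED MODULO THE CORE INPUTS AND THE NAMED SCHEDULE HYPOTHESES.** The joint a-priori loop
discharges the in-hop hypotheses `hA` of `HopTube.near_hop_of_pseudoFlows_amp` and `hbd`/`hEtop` of
`R54.behindEnergyClause_hop_topInput`: from the template bounds, the core inputs `r`, the initial levels, the two rates,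
the three closing inequalities, the near template residual `R_T` and the two budgets, the re-centred landing state satisfies
`NearClause (n+1)` AND `BehindEnergyClause K θ′ W′`.
[cite: Tao2016AveragedNS, §4 (4.1), (4.3), (4.5), (4.8), §6.3–6.4 (statement shape); route TaoLadderRungTwoFlat, `HopTube.TubeStepNear` + R54-1 behind (cell LADDER §49, §54–§56, referee c88 W-25)] -/
theorem near_behind_hop_of_schedule (P : TubeSchedule) {i₀ : Fin 2} {ustar : Fin 2 → ℤ → ℝ}
    (hW : PseudoFlowOnShift shiftSetFlat τ ε₀ (mirrorTable ε ε) 0 κ₂ W₀ FW₀ BW₀ W FW)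
    (hS : PseudoFlowOnShift shiftSetFlat τ ε₀ (mirrorTable ε ε) 0 κ₂' S₀ FS₀ BS₀ S FS)
    (hε : 0 ≤ ε) (hε₀ : 0 < ε₀) (hDK : P.K + 1 ≤ P.D)
    {θ' σ τ₁ a Aeff A A₀ A₁ M M₁ r μN μB V₀N V₀B VbarN VbarB RT W' : ℝ} {n : ℕ}
    (hθV : 0 ≤ P.θV) (hθ : 0 ≤ θ') (hθ5 : θ' ≤ 5 * Real.log (1 + ε₀)) (hAeff : 0 < Aeff)
    (hτ₁ : 0 < τ₁) (hτ₁τ : τ₁ ≤ τ) (hστ : σ * τ₁ = 1) (ha : 0 < a)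
    (hM0 : 0 ≤ M) (hM : ∀ t ∈ Icc 0 τ₁, ∀ i, ∀ m ∈ Finset.Icc (-(P.D : ℤ)) (1 - (P.K : ℤ)), |W i m t| ≤ M)
    (hM₁ : ∀ t ∈ Icc 0 τ₁, |W 1 (-(P.K : ℤ)) t| ≤ M₁)
    (hr : ∀ t ∈ Icc 0 τ₁, ∀ i, |(S - W) i (1 - (P.K : ℤ)) t| ≤ r) (hr0 : 0 ≤ r)
    (hAdef : A = Aeff / clock ε₀ (-(P.D : ℤ) - 1) + M) (hA₀def : A₀ = M + r)
    (hA₁def : A₁ = M₁ + Real.sqrt (2 * VbarN) * Real.exp (P.θV / 2))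
    (hrA : r ≤ A) (hA₀le : A₀ ≤ Aeff)
    (hV₀N : coMovingEnergyOn (Finset.Icc (1 - (P.D : ℤ)) (-(P.K : ℤ))) P.θV (-(P.K : ℝ)) (S - W) 0 ≤ V₀N)
    (hV₀B : ∀ L : ℕ, coMovingEnergyOn (Finset.Icc (1 - (P.K : ℤ) - L) (-(P.K : ℤ))) θ' (-(P.K : ℝ)) S 0 ≤ V₀B)
    (hμN : 0 < μN)
    (hμNle : μN ≤ σ * P.θV - 2 * (1 + ε) * 1 * (A * Real.sinh (P.θV / 2) + M * (3 + Real.exp P.θV)))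
    (hμB : 0 < μB) (hμBle : μB ≤ σ * θ' - 2 * (1 + ε) * Aeff * Real.sinh (θ' / 2))
    (hlevN : V₀N + (Real.exp (P.θV * ((1 : ℝ) - P.D + P.K)) * ((1 + ε) * 1 * A ^ 2 * (A + M))
        + (1 + ε) * 1 * r * (A ^ 2 + M * r)) * τ₁ < VbarN)
    (hlevB : V₀B + A₁ * A₀ * (A₁ + ε * A₀) * τ₁ < VbarB)
    (hclose : Real.sqrt (2 * VbarB) * Real.exp (θ' / 2) ≤ Aeff)
    (hR : ∑ k ∈ Finset.Icc (-(P.D : ℤ)) (-(P.K : ℤ) - 1), Real.exp (P.θV * ((k : ℝ) + P.K)) *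
        ∑ i : Fin 2, (W i (1 + k) τ₁ - |S i₀ 1 τ₁| / P.Astar * ustar i k) ^ 2 / 2 ≤ RT)
    (hbudgetN : (Real.sqrt (Real.exp (-μN * τ₁) * V₀N +
        (Real.exp (P.θV * ((1 : ℝ) - P.D + P.K)) * ((1 + ε) * 1 * A ^ 2 * (A + M)) + (1 + ε) * 1 * r * (A ^ 2 + M * r))
          * (1 - Real.exp (-μN * τ₁)) / μN) + Real.sqrt RT) ^ 2 ≤ a ^ 2 * P.v (n + 1))
    (hbudgetB : Real.exp (-μB * τ₁) * V₀B + A₁ * A₀ * (A₁ + ε * A₀) * (1 - Real.exp (-μB * τ₁)) / μB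
        ≤ a ^ 2 * W') :
    NearClause P i₀ ustar (n + 1) (recentre S τ₁ a) ∧ BehindEnergyClause P.K θ' W' (recentre S τ₁ a) := by
  have hσ : 0 < σ := pos_of_mul_pos_left (by rw [hστ]; exact one_pos) hτ₁.le
  obtain ⟨hbd, hAmp, -, hA₁⟩ := near_behind_apriori_of_pseudoFlows hW hS hε hε₀ hDK hθV hθ hθ5 hAeff hτ₁ hτ₁τ hστ
    hM0 hM hM₁ hr hr0 hAdef hA₀def hA₁def hrA hA₀le hV₀N hV₀B hμN hμNle hμB hμBle hlevN hlevB hclose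
  refine ⟨?_, ?_⟩
  · exact near_hop_of_pseudoFlows_amp P hW hS hε hε₀.le hθV hDK hτ₁ hτ₁τ hστ ha hM0
      (fun t ht => hAmp t ⟨ht.1.le, ht.2.le⟩) (fun t ht => hM t ⟨ht.1.le, ht.2.le⟩)
      (fun t ht => hr t ⟨ht.1.le, ht.2.le⟩ 0) hrA hμN hμNle hV₀N hR hbudgetN
  · have hA₀ : ∀ t ∈ Icc 0 τ₁, |S 0 (-(P.K : ℤ) + 1) t| ≤ A₀ := fun t ht => by
      rw [hA₀def]; exact coreBottom_amp_le hDK (hM t ht) (hr t ht)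
    have hEtop : ∀ t ∈ Ioo 0 τ₁,
        Real.exp (θ' * ((((-(P.K : ℤ)) : ℤ) : ℝ) - (-(P.K : ℝ) + σ * t))) * |fluxT ε ε₀ S (-(P.K : ℤ)) t|
          ≤ A₁ * A₀ * (A₁ + ε * A₀) := fun t ht =>
      weighted_topFlux_le hε hε₀.le hθ P.K S (mul_pos hσ ht.1).le (hA₁ t ⟨ht.1.le, ht.2.le⟩)
        (hA₀ t ⟨ht.1.le, ht.2.le⟩)
    exact behindEnergyClause_hop_topInput hS hε hε₀ hθ hAeff.le hτ₁ hτ₁τ hστ ha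
      (fun t ht n hn => hbd t ⟨ht.1.le, ht.2.le⟩ n hn) hEtop hV₀B hbudgetB hμB hμBle

end Joint

end Summit.NavierStokesRegularity.NavierStokesRegularity.Theorems.HopTube.R54

end
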